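import Mathlib.Analysis.InnerProductSpace.Calculus
import Mathlib.Analysis.Calculus.Deriv.Star
import Mathlib.Analysis.Calculus.Deriv.Inv
import Mathlib.Analysis.Calculus.Deriv.MeanValue
import Mathlib.Analysis.SpecialFunctions.Sqrt
import HarnessLib

/-!
# The modulus of a complex solution is a supersolution: Wronskian comparison with real solutions

Topic `Literature/Analysis/ODE` (namespace `Literature.Analysis.ODE`). Let `u` be a COMPLEX solution
of the real equation `u″ = q(x) u` on `[α, β]` which does not vanish there, and `n = |u|` its
modulus. Then `n` is `C²` with
`n′ = Re(ū u′)/|u|`, `n″ = q n + (|u′|² − n′²)/n ≥ q n`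
(`hasDerivAt_norm_of_ne_zero`, `hasDerivAt_normDeriv`, `re_conj_mul_sq_le`): the modulus is a
SUPERSOLUTION (the defect `(|u′|² − n′²)/n = F²/n³ ≥ 0` is the centrifugal term of the conserved flux
`F = Im(ū u′)`, the Ermakov–Pinney structure). Consequently, for every REAL solution `y ≥ 0` of the
same equation, the Wronskian `y n′ − n y′` is non-decreasing (`wronskian_norm_monotoneOn`), and if
it is `≥ 0` at `α` and `y > 0`, then `n/y` is non-decreasing (`norm_div_monotoneOn`): **the modulus of
a complex solution grows at least as fast as the real solution with the same logarithmic derivative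
at the initial point** (`norm_mul_le_norm_mul`: `|u(α)|·y(x) ≤ |u(x)|·y(α)`).

This is the elementary "no cancellation" mechanism for complex solutions carrying flux through a
classically forbidden region: whatever the phase of `u`, `|u|` cannot do worse than the comparison
real solution. Everything is proved; hypotheses are pointwise `HasDerivAt` statements on `[α, β]`.

## References
* P. Hartman, *Ordinary Differential Equations* (SIAM Classics 38, 2002), Ch. XI §2–§3 (Wronskian
  and Sturm comparison for sub/supersolutions).
* E. Pinney, *The nonlinear differential equation y″ + p(x)y + c y⁻³ = 0*, Proc. AMS 1 (1950) 681
  (the modulus equation `n″ = q n + F²/n³`).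
-/

noncomputable section

open Set Filter Topology
open scoped ComplexConjugate RealInnerProductSpace

namespace Literature.Analysis.ODE

/-! ### Derivatives of the modulus -/

/-- **`|u|′ = Re(ū u′)/|u|`** at a point where `u ≠ 0`. [folklore] -/
theorem hasDerivAt_norm_of_ne_zero {u : ℝ → ℂ} {u' : ℂ} {x : ℝ} (hu : HasDerivAt u u' x)
    (h0 : u x ≠ 0) :
    HasDerivAt (fun y => ‖u y‖) ((conj (u x) * u').re / ‖u x‖) x := by
  have hn : ‖u x‖ ≠ 0 := norm_ne_zero_iff.2 h0
  have hsq : ‖u x‖ ^ 2 ≠ 0 := pow_ne_zero 2 hn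
  have h := (hu.norm_sq).sqrt hsq
  have e1 : (fun y => Real.sqrt (‖u y‖ ^ 2)) = fun y => ‖u y‖ := by
    funext y; exact Real.sqrt_sq (norm_nonneg _)
  rw [e1, Real.sqrt_sq (norm_nonneg _)] at h
  refine h.congr_deriv ?_
  rw [Complex.inner, mul_comm u']
  field_simp

/-- The Cauchy–Schwarz defect of the modulus: `(Re(ū v))² ≤ |u|²|v|²`, i.e. `|u|′² ≤ |u′|²`.
[folklore] -/
theorem re_conj_mul_sq_le (u v : ℂ) : (conj u * v).re ^ 2 ≤ ‖u‖ ^ 2 * ‖v‖ ^ 2 := by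
  have h1 : (conj u * v).re ^ 2 ≤ ‖conj u * v‖ ^ 2 := by
    have := Complex.abs_re_le_norm (conj u * v)
    have h0 : 0 ≤ |(conj u * v).re| := abs_nonneg _
    nlinarith [sq_abs (conj u * v).re]
  rw [norm_mul, Complex.norm_conj, mul_pow] at h1
  exact h1

/-- **The modulus is `C²`: `(Re(ū u′)/|u|)′ = q|u| + (|u′|² − |u|′²)/|u|`** along `u″ = q u` at a
point where `u ≠ 0`. Precisely, with `n = |u(x)|` and `n₁ = Re(ū u′)/n`:
`(y ↦ Re(conj(u y) u′ y)/|u y|)′(x) = (|u′|² + q n² − n₁²)/n`. [folklore] -/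
theorem hasDerivAt_normDeriv {u u' : ℝ → ℂ} {q : ℝ → ℝ} {x : ℝ}
    (hu : HasDerivAt u (u' x) x) (hu' : HasDerivAt u' ((q x : ℂ) * u x) x) (h0 : u x ≠ 0) :
    HasDerivAt (fun y => (conj (u y) * u' y).re / ‖u y‖)
      ((‖u' x‖ ^ 2 + q x * ‖u x‖ ^ 2 - ((conj (u x) * u' x).re / ‖u x‖) ^ 2) / ‖u x‖) x := by
  have hn : ‖u x‖ ≠ 0 := norm_ne_zero_iff.2 h0
  -- numerator `h = Re(ū u′)` has derivative `|u′|² + q|u|²`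
  have hc : HasDerivAt (fun t => conj (u t)) (conj (u' x)) x := hu.star
  have hprod : HasDerivAt (fun t => conj (u t) * u' t)
      (conj (u' x) * u' x + conj (u x) * ((q x : ℂ) * u x)) x := hc.mul hu'
  have hre : HasDerivAt (fun t => (conj (u t) * u' t).re)
      ((conj (u' x) * u' x + conj (u x) * ((q x : ℂ) * u x)).re) x :=
    Complex.reCLM.hasFDerivAt.comp_hasDerivAt x hprod
  have e1 : (conj (u' x) * u' x + conj (u x) * ((q x : ℂ) * u x)).re = ‖u' x‖ ^ 2 + q x * ‖u x‖ ^ 2 := by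
    rw [Complex.add_re]
    have a1 : (conj (u' x) * u' x).re = ‖u' x‖ ^ 2 := by
      rw [Complex.conj_mul', ← Complex.ofReal_pow, Complex.ofReal_re]
    have a2 : (conj (u x) * ((q x : ℂ) * u x)).re = q x * ‖u x‖ ^ 2 := by
      have : conj (u x) * ((q x : ℂ) * u x) = (q x : ℂ) * (conj (u x) * u x) := by ring
      rw [this, Complex.conj_mul', ← Complex.ofReal_pow, ← Complex.ofReal_mul, Complex.ofReal_re]
    rw [a1, a2]
  rw [e1] at hre
  -- denominator `n = |u|` has derivative `Re(ū u′)/n`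
  have hnorm := hasDerivAt_norm_of_ne_zero hu h0
  have h := hre.div hnorm hn
  refine h.congr_deriv ?_
  field_simp

/-! ### The Wronskian of a real solution and the modulus is non-decreasing -/

/-- **`(y·|u|′ − |u|·y′)′ = y·(|u′|² − |u|′²)/|u| ≥ 0`**: for a complex solution `u ≠ 0` and a real
solution `y ≥ 0` of `·″ = q ·` on `[α, β]`, the Wronskian `x ↦ y(x)·|u|′(x) − |u(x)|·y′(x)` (with
`|u|′ = Re(ū u′)/|u|`) is non-decreasing on `[α, β]`. [folklore] -/
theorem wronskian_norm_monotoneOn {u u' : ℝ → ℂ} {y y' : ℝ → ℝ} {q : ℝ → ℝ} {α β : ℝ}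
    (hu : ∀ x ∈ Icc α β, HasDerivAt u (u' x) x ∧ HasDerivAt u' ((q x : ℂ) * u x) x)
    (hy : ∀ x ∈ Icc α β, HasDerivAt y (y' x) x ∧ HasDerivAt y' (q x * y x) x)
    (h0 : ∀ x ∈ Icc α β, u x ≠ 0) (hy0 : ∀ x ∈ Icc α β, 0 ≤ y x) :
    MonotoneOn (fun x => y x * ((conj (u x) * u' x).re / ‖u x‖) - ‖u x‖ * y' x) (Icc α β) := by
  -- the derivative of the Wronskian
  have hd : ∀ x ∈ Icc α β, HasDerivAt (fun x => y x * ((conj (u x) * u' x).re / ‖u x‖) - ‖u x‖ * y' x)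
      (y x * ((‖u' x‖ ^ 2 + q x * ‖u x‖ ^ 2 - ((conj (u x) * u' x).re / ‖u x‖) ^ 2) / ‖u x‖) -
        ‖u x‖ * (q x * y x) +
        (y' x * ((conj (u x) * u' x).re / ‖u x‖) - (conj (u x) * u' x).re / ‖u x‖ * y' x)) x := by
    intro x hx
    have h1 := ((hy x hx).1.mul (hasDerivAt_normDeriv (hu x hx).1 (hu x hx).2 (h0 x hx)))
    have h2 := ((hasDerivAt_norm_of_ne_zero (hu x hx).1 (h0 x hx)).mul (hy x hx).2)
    refine (h1.sub h2).congr_deriv ?_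
    ring
  refine monotoneOn_of_deriv_nonneg (convex_Icc α β)
    (fun x hx => (hd x hx).continuousAt.continuousWithinAt)
    (fun x hx => (hd x (interior_subset hx)).differentiableAt.differentiableWithinAt) ?_
  intro x hx
  have hx' : x ∈ Icc α β := interior_subset hx
  rw [(hd x hx').deriv]
  have hn : 0 < ‖u x‖ := norm_pos_iff.2 (h0 x hx')
  set n := ‖u x‖ with hn_def
  set h := (conj (u x) * u' x).re with hh
  -- simplify: the derivative equals `y · (|u′|² − (h/n)²)/n`
  have e : y x * ((‖u' x‖ ^ 2 + q x * n ^ 2 - (h / n) ^ 2) / n) - n * (q x * y x) +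
      (y' x * (h / n) - h / n * y' x) = y x * ((‖u' x‖ ^ 2 - (h / n) ^ 2) / n) := by
    field_simp
    ring
  rw [e]
  have hcs : (h / n) ^ 2 ≤ ‖u' x‖ ^ 2 := by
    rw [div_pow, div_le_iff₀ (by positivity)]
    have := re_conj_mul_sq_le (u x) (u' x)
    nlinarith
  have : 0 ≤ (‖u' x‖ ^ 2 - (h / n) ^ 2) / n := div_nonneg (by linarith) hn.le
  exact mul_nonneg (hy0 x hx') this

/-- **Comparison of logarithmic derivatives propagates**: under the hypotheses of
`wronskian_norm_monotoneOn`, if `y(α)|u|′(α) − |u(α)|y′(α) ≥ 0` then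
`y(x)|u|′(x) − |u(x)|y′(x) ≥ 0` for every `x ∈ [α, β]`. [folklore] -/
theorem wronskian_norm_nonneg {u u' : ℝ → ℂ} {y y' : ℝ → ℝ} {q : ℝ → ℝ} {α β : ℝ}
    (hu : ∀ x ∈ Icc α β, HasDerivAt u (u' x) x ∧ HasDerivAt u' ((q x : ℂ) * u x) x)
    (hy : ∀ x ∈ Icc α β, HasDerivAt y (y' x) x ∧ HasDerivAt y' (q x * y x) x)
    (h0 : ∀ x ∈ Icc α β, u x ≠ 0) (hy0 : ∀ x ∈ Icc α β, 0 ≤ y x)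
    (hα : 0 ≤ y α * ((conj (u α) * u' α).re / ‖u α‖) - ‖u α‖ * y' α) {x : ℝ} (hx : x ∈ Icc α β) :
    0 ≤ y x * ((conj (u x) * u' x).re / ‖u x‖) - ‖u x‖ * y' x :=
  hα.trans (wronskian_norm_monotoneOn hu hy h0 hy0 (left_mem_Icc.2 (hx.1.trans hx.2)) hx hx.1)

/-- **The modulus grows at least like the comparison solution**: complex `u ≠ 0` and real `y > 0`
solve `·″ = q ·` on `[α, β]`, and at `α` the logarithmic derivatives compare,
`y(α)|u|′(α) − |u(α)|y′(α) ≥ 0`. Then `|u|/y` is non-decreasing on `[α, β]`. [folklore] -/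
theorem norm_div_monotoneOn {u u' : ℝ → ℂ} {y y' : ℝ → ℝ} {q : ℝ → ℝ} {α β : ℝ}
    (hu : ∀ x ∈ Icc α β, HasDerivAt u (u' x) x ∧ HasDerivAt u' ((q x : ℂ) * u x) x)
    (hy : ∀ x ∈ Icc α β, HasDerivAt y (y' x) x ∧ HasDerivAt y' (q x * y x) x)
    (h0 : ∀ x ∈ Icc α β, u x ≠ 0) (hy0 : ∀ x ∈ Icc α β, 0 < y x)
    (hα : 0 ≤ y α * ((conj (u α) * u' α).re / ‖u α‖) - ‖u α‖ * y' α) :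
    MonotoneOn (fun x => ‖u x‖ / y x) (Icc α β) := by
  have hd : ∀ x ∈ Icc α β, HasDerivAt (fun x => ‖u x‖ / y x)
      (((conj (u x) * u' x).re / ‖u x‖ * y x - ‖u x‖ * y' x) / y x ^ 2) x :=
    fun x hx => (hasDerivAt_norm_of_ne_zero (hu x hx).1 (h0 x hx)).div (hy x hx).1 (hy0 x hx).ne'
  refine monotoneOn_of_deriv_nonneg (convex_Icc α β)
    (fun x hx => (hd x hx).continuousAt.continuousWithinAt)
    (fun x hx => (hd x (interior_subset hx)).differentiableAt.differentiableWithinAt) ?_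
  intro x hx
  have hx' : x ∈ Icc α β := interior_subset hx
  rw [(hd x hx').deriv]
  have hW := wronskian_norm_nonneg hu hy h0 (fun x hx => (hy0 x hx).le) hα hx'
  have e : (conj (u x) * u' x).re / ‖u x‖ * y x - ‖u x‖ * y' x =
      y x * ((conj (u x) * u' x).re / ‖u x‖) - ‖u x‖ * y' x := by ring
  rw [e]
  exact div_nonneg hW (sq_nonneg _)

/-- **Modulus comparison, product form**: under the hypotheses of `norm_div_monotoneOn`,
`|u(α)|·y(x) ≤ |u(x)|·y(α)` for every `x ∈ [α, β]` — the modulus of the complex solution grows at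
least as fast as the real comparison solution. [folklore] -/
theorem norm_mul_le_norm_mul {u u' : ℝ → ℂ} {y y' : ℝ → ℝ} {q : ℝ → ℝ} {α β : ℝ}
    (hu : ∀ x ∈ Icc α β, HasDerivAt u (u' x) x ∧ HasDerivAt u' ((q x : ℂ) * u x) x)
    (hy : ∀ x ∈ Icc α β, HasDerivAt y (y' x) x ∧ HasDerivAt y' (q x * y x) x)
    (h0 : ∀ x ∈ Icc α β, u x ≠ 0) (hy0 : ∀ x ∈ Icc α β, 0 < y x)
    (hα : 0 ≤ y α * ((conj (u α) * u' α).re / ‖u α‖) - ‖u α‖ * y' α) {x : ℝ} (hx : x ∈ Icc α β) :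
    ‖u α‖ * y x ≤ ‖u x‖ * y α := by
  have hαmem : α ∈ Icc α β := left_mem_Icc.2 (hx.1.trans hx.2)
  have h := norm_div_monotoneOn hu hy h0 hy0 hα hαmem hx hx.1
  simp only at h
  rw [div_le_div_iff₀ (hy0 α hαmem) (hy0 x hx)] at h
  linarith

/-- **Special case: a modulus that is not decreasing at `α` dominates the even solution.** If
`Re(ū u′)(α) ≥ 0` and `c` is the real solution with `c(α) = 1`, `c′(α) = 0`, positive on `[α, β]`
(e.g. `q ≥ 0` there, where `c ≥ 1` is `cosh`-like), then `|u(x)| ≥ |u(α)|·c(x)` on `[α, β]`.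
[folklore] -/
theorem norm_mul_le_norm_of_even {u u' : ℝ → ℂ} {c c' : ℝ → ℝ} {q : ℝ → ℝ} {α β : ℝ}
    (hu : ∀ x ∈ Icc α β, HasDerivAt u (u' x) x ∧ HasDerivAt u' ((q x : ℂ) * u x) x)
    (hc : ∀ x ∈ Icc α β, HasDerivAt c (c' x) x ∧ HasDerivAt c' (q x * c x) x)
    (h0 : ∀ x ∈ Icc α β, u x ≠ 0) (hc0 : ∀ x ∈ Icc α β, 0 < c x) (hcα : c α = 1) (hc'α : c' α = 0)
    (hα : 0 ≤ (conj (u α) * u' α).re) {x : ℝ} (hx : x ∈ Icc α β) :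
    ‖u α‖ * c x ≤ ‖u x‖ := by
  have hW : 0 ≤ c α * ((conj (u α) * u' α).re / ‖u α‖) - ‖u α‖ * c' α := by
    rw [hcα, hc'α, one_mul, mul_zero, sub_zero]
    exact div_nonneg hα (norm_nonneg _)
  have h := norm_mul_le_norm_mul hu hc h0 hc0 hW hx
  rw [hcα, mul_one] at h
  exact h

end Literature.Analysis.ODE

end
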